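import Mathlib
import HarnessLib
import Summits.HubbardSuperconductivity.HubbardSuperconductivity.Theorems.KLProgrammeKLRegimeTwoVolumeDualRowsLastScaleConversion
import Summits.HubbardSuperconductivity.HubbardSuperconductivity.Theorems.KLProgrammeKLRegimeTwoVolumeFrameConversionRowsFourier
import Summits.HubbardSuperconductivity.HubbardSuperconductivity.Theorems.KLProgrammeKLRegimeTwoVolumeUVRowsTwoM

/-!
# Route `KLProgramme` — crux K3 ENGINE (stmt-HubbardSuperconductivity-20437 `KLRegimeEngineV17F2`), stub (e) proof-input «(e)-D-ROWS», keying (A′) (pen (R495)):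
# THE FOUR NAMED DATA OF ✓ p733418 REDUCE TO TWO — `Pe ≤ N_D²·ρ + 2·N_D·ρ·(2 + ε·N_D·ρ)·S` at the VL reading scale `n′ = nScales β + 1`
# (cell gate-hubbard-kl, seat hubbard-kl-k3c4-p1 g27, VL lane; file (1c) of the order of record (R495)(C), part 2 = assembly of `…TwoVolumeFrameConversionRowsFourier` into
# `…TwoVolumeDualRowsLastScaleConversion.hPe_lastScale_le` / `hdualSp_point_lastScale_of_commonFrame`)

With `N_D ≥ Σ_z‖framePosKernel L₂ D z‖` (`D = K₂ ⊖ K₁`, the flow frames of the two volumes at `n′`), `ρ ≥` the `ℓ¹` norm of the `2M₂`-lattice character sum of the padded grid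
symbol of the frame-`K₁` ultraviolet symbol at `Λ_{n′}` on the fine volume (the LHS of Literature `sum_sum_norm_charSum_gridSymbol_uvSymbolCT_le` at `N = 2M₂`, every spin) and
`S ≥` the `ε`-weighted pinned raw two-leg rows of `T^{L₂}(K₁)`:

* **`hPe_lastScale_le_of_fourier`** — the conversion rows `Pe` of `hPd_of_commonFrame_add_conversion` are `≤ N_D²·ρ + 2·N_D·ρ·(2 + ε·N_D·ρ)·S`
  (`hPe_lastScale_le` at `Xχ := N_D²ρ/2`, `Rδ = Cδ := ε·N_D·ρ`, `Cv := 1 + ε·N_D·ρ`, all four discharged by `…FrameConversionRowsFourier`);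
* **`hdualSp_point_lastScale_of_fourier`** — composed with ✓ p732040: the body of `hdualSp` at `n′ = nScales β + 1` from the COMMON-FRAME pinned defect `Pc`, the far rows `Pf`,
  and the budget `ε·(Pc σ + N_D²ρ + 2N_Dρ(2 + εN_Dρ)S) ≤ Dd/L₁`.

* **`hdualSp_point_lastScale_of_frameOK`** — `ρ` DISCHARGED by ✓ `ScaleZeroDecay.eps_mul_charSum_gridSymbol_twoM_le_A1` (`…TwoVolumeUVRowsTwoM`): for an admissible
  coarse frame `K₁` (`FrameOK`), `klBetaMin ≤ β`, `β³ ≤ M₂`, the budget reads `ε·Pc σ + (N_D²A⋆ + 2N_D·A⋆·(2 + N_D·A⋆)·S) ≤ Dd/L₁` with the EXPLICIT β-dependent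
  constant `A⋆ = 14√Q_{nScales β+1}` (crude: `∝ Λ_{n⋆}^{-3}`); only `N_D` (frame rates) and `S` (one-volume raw two-leg rows) remain as data.

LEDGER LINE (for the pen): `ε·Pe ≤ N_D²·(ερ) + 2·N_D·(ερ)·(2 + N_D·(ερ))·S`; `N_D ≤ coeffNorm 0 (K₂ ⊖ K₁)` is `1/L₁` times the frame-rate sum of `hVL`'s antecedent, and `ερ` is the
`L¹(dτ·Σ_x⃗)` norm of the frame-`K₁` covariance above `Λ_{n′} < π/β` — the one β-dependent constant of the conversion (crude uniform value: Literature radicand at `N′ = 2M`, next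
file; sharp value: sector counting).  Pure composition; the data, `hVL`, the window, K3 and superconductivity remain unasserted.
References: BGM 2006 §2.3 (2.21)–(2.24), §2.4 (2.38), §2.7 (2.71a), §3 (3.3) [cite: BenfattoGiulianiMastropietro2006]; Feldman–Salmhofer–Trubowitz 1996 §1.
-/

noncomputable section

namespace Summit.HubbardSuperconductivity.HubbardSuperconductivity.Theorems.TwoVolumeDefect

set_option linter.dupNamespace false -- summit = problem name (single-conjunct summit), D-0017

open Finset Complex Literature.MathematicalPhysics.QuantumLattice Literature.Probability.LatticeModels GrassmannAlgebra
open Summit.HubbardSuperconductivity.HubbardSuperconductivity.Theorems.KLRegimeSplit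
open Summit.HubbardSuperconductivity.HubbardSuperconductivity.Theorems.KLProgrammeLegKernels
open Summit.HubbardSuperconductivity.HubbardSuperconductivity.Theorems.TorusFourierL2
open Summit.HubbardSuperconductivity.HubbardSuperconductivity.Theorems.EngineV8
open Literature.MathematicalPhysics.QuantumLattice.FermiRG

/-! ## §4 Assembly at the VL reading scale: `Pe ≤ N_D²·ρ + 2·N_D·ρ·(2 + ε·N_D·ρ)·S` -/

section LastScale

variable {L₁ L₂ M₂ : ℕ} [NeZero L₁] [NeZero L₂] [NeZero M₂]

/-- Monotone bookkeeping for the uniform form: if `ε·ρ ≤ A` then `ε·(N_D²ρ + 2N_Dρ(2 + εN_Dρ)S) ≤ N_D²A + 2N_D·A·(2 + N_D·A)·S`. -/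
theorem eps_mul_conversionBound_le {ε N_D ρ S A : ℝ} (hε : 0 ≤ ε) (hN : 0 ≤ N_D) (hρ : 0 ≤ ρ) (hS : 0 ≤ S) (hA : ε * ρ ≤ A) :
    ε * (N_D ^ 2 * ρ + 2 * N_D * ρ * (2 + ε * N_D * ρ) * S) ≤ N_D ^ 2 * A + 2 * N_D * A * (2 + N_D * A) * S := by
  have ha0 : 0 ≤ ε * ρ := mul_nonneg hε hρ
  have heq : ε * (N_D ^ 2 * ρ + 2 * N_D * ρ * (2 + ε * N_D * ρ) * S) =
      N_D ^ 2 * (ε * ρ) + 2 * N_D * (ε * ρ) * (2 + N_D * (ε * ρ)) * S := by ring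
  rw [heq]
  have h1 : N_D ^ 2 * (ε * ρ) ≤ N_D ^ 2 * A := mul_le_mul_of_nonneg_left hA (sq_nonneg _)
  have h2 : 2 * N_D * (ε * ρ) ≤ 2 * N_D * A := mul_le_mul_of_nonneg_left hA (by positivity)
  have h3 : 2 + N_D * (ε * ρ) ≤ 2 + N_D * A := by nlinarith [mul_le_mul_of_nonneg_left hA hN]
  have hA0 : 0 ≤ A := ha0.trans hA
  have h4 : 2 * N_D * (ε * ρ) * (2 + N_D * (ε * ρ)) * S ≤ 2 * N_D * A * (2 + N_D * A) * S :=
    mul_le_mul_of_nonneg_right (mul_le_mul h2 h3 (by positivity) (by positivity)) hS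
  linarith

/-- **THE CONVERSION ROWS AT THE LAST SCALE FROM TWO FOURIER DATA.**  Fine volume `L₂`, coarse `L₁ ≤ L₂`, `0 < β`, `n′ = nScales β + 1`, frames
`K₁ = klFlowFrameU L₁ M₂ … n′`, `K₂ = klFlowFrameU L₂ M₂ … n′`, `D = K₂ ⊖ K₁`, frame-`K₁` partition function of the fine volume a unit.  DATA: `N_D ≥ Σ_z‖framePosKernel L₂ D z‖`
(the `ℓ¹` norm of the mismatch polynomial's position kernel), `ρ ≥` the `ℓ¹` norm of the `2M₂`-lattice character sum of the padded grid symbol of `Ψ_{K₁}` at `Λ_{n′}` (every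
spin; the LHS of Literature `sum_sum_norm_charSum_gridSymbol_uvSymbolCT_le` at `N = 2M₂`), `S ≥` the `ε`-weighted pinned raw two-leg rows of `T^{L₂}(K₁)`.  THEN the `hPe` rows
of `…DualRowsFrameSplit.hPd_of_commonFrame_add_conversion` are `≤ N_D²·ρ + 2·N_D·ρ·(2 + ε·N_D·ρ)·S` (`ε = β/(2M₂)`): `hPe_lastScale_le` at `Xχ := N_D²ρ/2`,
`Rδ = Cδ := ε·N_D·ρ`, `Cv := 1 + ε·N_D·ρ`. [cite: BenfattoGiulianiMastropietro2006, §2.3 (2.21)–(2.24), §2.7 (2.71a), §3 (3.3)] -/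
theorem hPe_lastScale_le_of_fourier (hL : L₁ ≤ L₂) {β : ℝ} (hβ : 0 < β) (U μ : ℝ) (of : SpaceTimeIdx L₂ M₂)
    (hZ₁ : IsUnit (effPartitionFn ℂ (normalCovariance L₂ M₂ (uvSymbolCT L₂ M₂ β μ (klFlowFrameU L₁ M₂ β U μ (nScales β + 1)) (klScale klE0 (nScales β + 1))))
      (hubbardInteraction L₂ M₂ β U + counterQuadratic L₂ M₂ β (klFlowFrameU L₁ M₂ β U μ (nScales β + 1)))))
    {N_D ρ S : ℝ} (hS0 : 0 ≤ S)
    (hND : ∑ z : TorusSite 2 L₂, ‖framePosKernel L₂ (fsub (klFlowFrameU L₂ M₂ β U μ (nScales β + 1)) (klFlowFrameU L₁ M₂ β U μ (nScales β + 1))) z‖ ≤ N_D)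
    (hρ : ∀ τ : Fin 2, ∑ a : TorusSite 1 (2 * M₂), ∑ bv : TorusSite 2 L₂, ‖∑ q₀ : TorusSite 1 (2 * M₂), ∑ qv : TorusSite 2 L₂,
      torusChar q₀ a * torusChar qv bv *
        gridSymbol L₂ M₂ (2 * M₂) β (uvSymbolCT L₂ M₂ β μ (klFlowFrameU L₁ M₂ β U μ (nScales β + 1)) (klScale klE0 (nScales β + 1))) τ q₀ qv‖ ≤ ρ)
    (hS : ∀ (σ : Fin 2) (y₀ : SpaceTimeIdx L₂ M₂),
      fixedTupleL1 L₂ M₂ β 1 (sectorisedKernel L₂ M₂ β (trivialMultiplier L₂ M₂)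
          (klEffectiveAction L₂ M₂ β U μ (klFlowFrameU L₁ M₂ β U μ (nScales β + 1)) klE0 (nScales β + 1)) 2)
        (![((0, σ), 0), ((0, σ), 1)] : Fin 2 → SectorLeg 1) y₀ ≤ S)
    (σ : Fin 2) :
    ∑ t₁ : ImagTimeIdx M₂, ∑ ybar : TorusSite 2 L₁,
        (‖sectorisedKernel L₂ M₂ β (trivialMultiplier L₂ M₂)
              ((klEffectiveAction L₂ M₂ β U μ (klFlowFrameU L₁ M₂ β U μ (nScales β + 1)) klE0 (nScales β + 1) -
                  counterQuadratic L₂ M₂ β (klFlowFrameU L₁ M₂ β U μ (nScales β + 1))) -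
                (klEffectiveAction L₂ M₂ β U μ (klFlowFrameU L₂ M₂ β U μ (nScales β + 1)) klE0 (nScales β + 1) -
                  counterQuadratic L₂ M₂ β (klFlowFrameU L₂ M₂ β U μ (nScales β + 1)))) 2
              (![((0, σ), 0), ((0, σ), 1)] : Fin 2 → SectorLeg 1) ![of, (t₁, of.2 + Torus.proj L₂ (Torus.cRep ybar))]‖ +
          ‖sectorisedKernel L₂ M₂ β (trivialMultiplier L₂ M₂)
              ((klEffectiveAction L₂ M₂ β U μ (klFlowFrameU L₁ M₂ β U μ (nScales β + 1)) klE0 (nScales β + 1) -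
                  counterQuadratic L₂ M₂ β (klFlowFrameU L₁ M₂ β U μ (nScales β + 1))) -
                (klEffectiveAction L₂ M₂ β U μ (klFlowFrameU L₂ M₂ β U μ (nScales β + 1)) klE0 (nScales β + 1) -
                  counterQuadratic L₂ M₂ β (klFlowFrameU L₂ M₂ β U μ (nScales β + 1)))) 2
              (![((0, σ), 0), ((0, σ), 1)] : Fin 2 → SectorLeg 1) ![of, (t₁, of.2 + -Torus.proj L₂ (Torus.cRep ybar))]‖) ≤
      N_D ^ 2 * ρ + 2 * N_D * ρ * (2 + imagTimeWeight β M₂ * N_D * ρ) * S := by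
  -- abbreviations
  set n := nScales β + 1 with hn
  set K₁ := klFlowFrameU L₁ M₂ β U μ n with hK₁
  set K₂ := klFlowFrameU L₂ M₂ β U μ n with hK₂
  set ε := imagTimeWeight β M₂ with hεdef
  have hMr : (0 : ℝ) < M₂ := Nat.cast_pos.2 (NeZero.pos M₂)
  have hε : 0 < ε := by rw [hεdef]; unfold imagTimeWeight; positivity
  have hL2 : (0 : ℝ) < (L₂ : ℝ) ^ 2 := by have := NeZero.pos L₂; positivity
  have hc0 : (0 : ℝ) < β * (L₂ : ℝ) ^ 2 := by positivity
  have hL1 : (L₂ : ℝ) ≠ 0 := by exact_mod_cast NeZero.ne L₂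
  have hN0 : 0 ≤ N_D := (sum_nonneg fun _ _ => norm_nonneg _).trans hND
  have hρ0 : 0 ≤ ρ := le_trans (sum_nonneg fun _ _ => sum_nonneg fun _ _ => norm_nonneg _) (hρ 0)
  have hΛ : 0 < klScale klE0 n := klScale_nScales_succ_pos
  have hΛβ : klScale klE0 n ≤ Real.pi / β := (klScale_nScales_succ_lt hβ).le
  -- the dressing scalar `c = −(βL²)⁻¹`, `‖c‖·βL² = 1`
  set c : ℂ := -(((1 / (β * (L₂ : ℝ) ^ 2) : ℝ) : ℂ)) with hc
  have hnc : ‖c‖ * (β * (L₂ : ℝ) ^ 2) = 1 := by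
    rw [hc, norm_neg, Complex.norm_real, Real.norm_eq_abs, abs_of_pos (by positivity)]; field_simp
  -- the three weights of the dressing family `![1, m − 1, m]`
  set F' : Fin 3 → FreqMomentum L₂ M₂ → ℂ := ![fun _ => 1,
      fun k => (1 + uvSymbolCT L₂ M₂ β μ K₂ (klScale klE0 n) (k, 0) * (((fsub K₂ K₁).eval (latticeMomentum L₂ k.2) / (β * (L₂ : ℝ) ^ 2) : ℝ) : ℂ))⁻¹ - 1,
      fun k => (1 + uvSymbolCT L₂ M₂ β μ K₂ (klScale klE0 n) (k, 0) * (((fsub K₂ K₁).eval (latticeMomentum L₂ k.2) / (β * (L₂ : ℝ) ^ 2) : ℝ) : ℂ))⁻¹] with hF'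
  have hF1 : ∀ k : FreqMomentum L₂ M₂, F' 1 k =
      ((fsub K₂ K₁).eval (latticeMomentum L₂ k.2) : ℂ) * (c * uvSymbolCT L₂ M₂ β μ K₁ (klScale klE0 n) (k, 0)) := by
    intro k
    have hm := dressWeight_sub_one_eq_of_scale_le_pi_div hβ μ K₁ K₂ klE0 n hΛ hΛβ (k, 0)
    simp only at hm
    have e1 : F' 1 k = (1 + uvSymbolCT L₂ M₂ β μ K₂ (klScale klE0 n) (k, 0) *
        (((fsub K₂ K₁).eval (latticeMomentum L₂ k.2) / (β * (L₂ : ℝ) ^ 2) : ℝ) : ℂ))⁻¹ - 1 := rfl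
    rw [e1, hm, hc]; push_cast; ring
  have hF2 : ∀ k : FreqMomentum L₂ M₂, F' 2 k =
      1 + ((fsub K₂ K₁).eval (latticeMomentum L₂ k.2) : ℂ) * (c * uvSymbolCT L₂ M₂ β μ K₁ (klScale klE0 n) (k, 0)) := by
    intro k
    have hm := dressWeight_sub_one_eq_of_scale_le_pi_div hβ μ K₁ K₂ klE0 n hΛ hΛβ (k, 0)
    simp only at hm
    have e1 : F' 1 k = (1 + uvSymbolCT L₂ M₂ β μ K₂ (klScale klE0 n) (k, 0) *
        (((fsub K₂ K₁).eval (latticeMomentum L₂ k.2) / (β * (L₂ : ℝ) ^ 2) : ℝ) : ℂ))⁻¹ - 1 := rfl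
    have e2 : F' 2 k = (1 + uvSymbolCT L₂ M₂ β μ K₂ (klScale klE0 n) (k, 0) *
        (((fsub K₂ K₁).eval (latticeMomentum L₂ k.2) / (β * (L₂ : ℝ) ^ 2) : ℝ) : ℂ))⁻¹ := rfl
    have h2 : F' 2 k = 1 + (F' 1 k) := by rw [e1, e2]; ring
    rw [h2, hF1]
  -- the four named data
  have hχ : ∀ τ : Fin 2, ∑ x₁ : SpaceTimeIdx L₂ M₂, ‖∑ k : FreqMomentum L₂ M₂,
      ((((fsub K₂ K₁).eval (latticeMomentum L₂ k.2) / (β * (L₂ : ℝ) ^ 2) : ℝ) : ℂ) /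
            (1 + uvSymbolCT L₂ M₂ β μ K₂ (klScale klE0 n) (k, τ) * (((fsub K₂ K₁).eval (latticeMomentum L₂ k.2) / (β * (L₂ : ℝ) ^ 2) : ℝ) : ℂ)) -
          (((fsub K₂ K₁).eval (latticeMomentum L₂ k.2) / (β * (L₂ : ℝ) ^ 2) : ℝ) : ℂ)) * (((2 : ℕ).factorial : ℚ)⁻¹ • (1 : ℂ)) *
        (Complex.exp (((matsubaraFreq β M₂ k.1 * (imagTime β M₂ x₁.1 - imagTime β M₂ of.1) : ℝ) : ℂ) * I) * torusChar k.2 (x₁.2 - of.2))‖ ≤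
      N_D ^ 2 * ρ / 2 := fun τ =>
    sum_norm_chainCharSum_le hβ μ K₁ K₂ klE0 n hΛ hΛβ hND τ (hρ τ) of
  have hRδ : ∀ τ : Fin 2, ∑ y : SpaceTimeIdx L₂ M₂,
      ‖(sectorAnalysisMatrix L₂ M₂ β F' * sectorSubMatrix L₂ M₂ β (trivialMultiplier L₂ M₂)) (of, (((1 : Fin 3), τ), 0)) (y, (((0 : Fin 1), τ), 0))‖ ≤
      ε * N_D * ρ / ε := by
    intro τ
    refine (rowSum_overlap_evalMul_le hβ F' 1 (fsub K₂ K₁) _ c 0 hF1 hND (hρ 0) τ 0 of).trans (le_of_eq ?_)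
    rw [hnc]; field_simp
  have hCδ : ∀ (τ : Fin 2) (y : SpaceTimeIdx L₂ M₂), ∑ x : SpaceTimeIdx L₂ M₂,
      ‖(sectorAnalysisMatrix L₂ M₂ β F' * sectorSubMatrix L₂ M₂ β (trivialMultiplier L₂ M₂)) (x, (((1 : Fin 3), τ), 1)) (y, (((0 : Fin 1), τ), 1))‖ ≤
      ε * N_D * ρ / ε := by
    intro τ y
    refine (colSum_overlap_evalMul_le hβ F' 1 (fsub K₂ K₁) _ c 0 hF1 hND (hρ 0) τ 1 y).trans (le_of_eq ?_)
    rw [hnc]; field_simp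
  have hCv : ∀ (τ : Fin 2) (y : SpaceTimeIdx L₂ M₂), ∑ x : SpaceTimeIdx L₂ M₂,
      ‖(sectorAnalysisMatrix L₂ M₂ β F' * sectorSubMatrix L₂ M₂ β (trivialMultiplier L₂ M₂)) (x, (((2 : Fin 3), τ), 1)) (y, (((0 : Fin 1), τ), 1))‖ ≤
      (1 + ε * N_D * ρ) / ε := by
    intro τ y
    refine (colSum_overlap_one_add_evalMul_le hβ F' 2 (fsub K₂ K₁) _ c 0 hF2 hND (hρ 0) τ 1 y).trans (le_of_eq ?_)
    rw [hnc, ← hεdef]; field_simp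
  have h := hPe_lastScale_le hL hβ U μ of hZ₁ (Xχ := N_D ^ 2 * ρ / 2) (Rδ := ε * N_D * ρ) (Cv := 1 + ε * N_D * ρ) (Cδ := ε * N_D * ρ)
    (by positivity) (by positivity) hS0 hχ hRδ hCv hCδ hS σ
  refine h.trans (le_of_eq ?_)
  rw [← hεdef]
  field_simp
  ring

/-- **`hdualSp` AT THE VL READING SCALE FROM THE COMMON-FRAME DEFECT AND THE TWO FOURIER DATA** — `hPe_lastScale_le_of_fourier` composed with
`…DualRowsFrameSplit.hdualSp_point_of_commonFrame_add_conversion` (p732040): with `ε·(Pc σ + (N_D²ρ + 2N_Dρ(2 + εN_Dρ)S)) ≤ Dd/L₁` and `ε·Pf σ ≤ Df/L₁` the body of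
`hdualSp` at `n′ = nScales β + 1` holds at the pins `(oc, of)`. [cite: BenfattoGiulianiMastropietro2006, §2.4 (2.38)] -/
theorem hdualSp_point_lastScale_of_fourier (hL : L₁ ≤ L₂) {β : ℝ} (hβ : 0 < β) (U μ : ℝ) (oc : SpaceTimeIdx L₁ M₂) (of : SpaceTimeIdx L₂ M₂)
    (ht : of.1 = oc.1)
    (hZ₁ : IsUnit (effPartitionFn ℂ (normalCovariance L₂ M₂ (uvSymbolCT L₂ M₂ β μ (klFlowFrameU L₁ M₂ β U μ (nScales β + 1)) (klScale klE0 (nScales β + 1))))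
      (hubbardInteraction L₂ M₂ β U + counterQuadratic L₂ M₂ β (klFlowFrameU L₁ M₂ β U μ (nScales β + 1)))))
    {N_D ρ S : ℝ} (hS0 : 0 ≤ S)
    (hND : ∑ z : TorusSite 2 L₂, ‖framePosKernel L₂ (fsub (klFlowFrameU L₂ M₂ β U μ (nScales β + 1)) (klFlowFrameU L₁ M₂ β U μ (nScales β + 1))) z‖ ≤ N_D)
    (hρ : ∀ τ : Fin 2, ∑ a : TorusSite 1 (2 * M₂), ∑ bv : TorusSite 2 L₂, ‖∑ q₀ : TorusSite 1 (2 * M₂), ∑ qv : TorusSite 2 L₂,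
      torusChar q₀ a * torusChar qv bv *
        gridSymbol L₂ M₂ (2 * M₂) β (uvSymbolCT L₂ M₂ β μ (klFlowFrameU L₁ M₂ β U μ (nScales β + 1)) (klScale klE0 (nScales β + 1))) τ q₀ qv‖ ≤ ρ)
    (hS : ∀ (σ : Fin 2) (y₀ : SpaceTimeIdx L₂ M₂),
      fixedTupleL1 L₂ M₂ β 1 (sectorisedKernel L₂ M₂ β (trivialMultiplier L₂ M₂)
          (klEffectiveAction L₂ M₂ β U μ (klFlowFrameU L₁ M₂ β U μ (nScales β + 1)) klE0 (nScales β + 1)) 2)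
        (![((0, σ), 0), ((0, σ), 1)] : Fin 2 → SectorLeg 1) y₀ ≤ S)
    {Pc Pf : Fin 2 → ℝ} {Dd Df : ℝ}
    (hPc : ∀ σ : Fin 2, ∑ t₁ : ImagTimeIdx M₂, ∑ ybar : TorusSite 2 L₁,
        (‖sectorisedKernel L₁ M₂ β (trivialMultiplier L₁ M₂)
              (klEffectiveAction L₁ M₂ β U μ (klFlowFrameU L₁ M₂ β U μ (nScales β + 1)) klE0 (nScales β + 1) - counterQuadratic L₁ M₂ β (klFlowFrameU L₁ M₂ β U μ (nScales β + 1))) 2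
              (![((0, σ), 0), ((0, σ), 1)] : Fin 2 → SectorLeg 1) ![oc, (t₁, oc.2 + ybar)] -
            sectorisedKernel L₂ M₂ β (trivialMultiplier L₂ M₂)
              (klEffectiveAction L₂ M₂ β U μ (klFlowFrameU L₁ M₂ β U μ (nScales β + 1)) klE0 (nScales β + 1) - counterQuadratic L₂ M₂ β (klFlowFrameU L₁ M₂ β U μ (nScales β + 1))) 2
              (![((0, σ), 0), ((0, σ), 1)] : Fin 2 → SectorLeg 1) ![of, (t₁, of.2 + Torus.proj L₂ (Torus.cRep ybar))]‖ +
          ‖sectorisedKernel L₁ M₂ β (trivialMultiplier L₁ M₂)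
              (klEffectiveAction L₁ M₂ β U μ (klFlowFrameU L₁ M₂ β U μ (nScales β + 1)) klE0 (nScales β + 1) - counterQuadratic L₁ M₂ β (klFlowFrameU L₁ M₂ β U μ (nScales β + 1))) 2
              (![((0, σ), 0), ((0, σ), 1)] : Fin 2 → SectorLeg 1) ![oc, (t₁, oc.2 + -ybar)] -
            sectorisedKernel L₂ M₂ β (trivialMultiplier L₂ M₂)
              (klEffectiveAction L₂ M₂ β U μ (klFlowFrameU L₁ M₂ β U μ (nScales β + 1)) klE0 (nScales β + 1) - counterQuadratic L₂ M₂ β (klFlowFrameU L₁ M₂ β U μ (nScales β + 1))) 2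
              (![((0, σ), 0), ((0, σ), 1)] : Fin 2 → SectorLeg 1) ![of, (t₁, of.2 + -Torus.proj L₂ (Torus.cRep ybar))]‖) ≤ Pc σ)
    (hPf : ∀ σ : Fin 2, ∑ t₁ : ImagTimeIdx M₂,
        ∑ y ∈ univ.filter (fun y : TorusSite 2 L₂ => Torus.proj L₂ (Torus.cRep (fun i => (((y i).val : ℕ) : ZMod L₁))) ≠ y),
          (‖sectorisedKernel L₂ M₂ β (trivialMultiplier L₂ M₂)
                (klEffectiveAction L₂ M₂ β U μ (klFlowFrameU L₂ M₂ β U μ (nScales β + 1)) klE0 (nScales β + 1) - counterQuadratic L₂ M₂ β (klFlowFrameU L₂ M₂ β U μ (nScales β + 1))) 2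
                (![((0, σ), 0), ((0, σ), 1)] : Fin 2 → SectorLeg 1) ![of, (t₁, of.2 + y)]‖ +
            ‖sectorisedKernel L₂ M₂ β (trivialMultiplier L₂ M₂)
                (klEffectiveAction L₂ M₂ β U μ (klFlowFrameU L₂ M₂ β U μ (nScales β + 1)) klE0 (nScales β + 1) - counterQuadratic L₂ M₂ β (klFlowFrameU L₂ M₂ β U μ (nScales β + 1))) 2
                (![((0, σ), 0), ((0, σ), 1)] : Fin 2 → SectorLeg 1) ![of, (t₁, of.2 + -y)]‖) ≤ Pf σ)
    (hDd : ∀ σ, imagTimeWeight β M₂ * (Pc σ + (N_D ^ 2 * ρ + 2 * N_D * ρ * (2 + imagTimeWeight β M₂ * N_D * ρ) * S)) ≤ Dd / L₁)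
    (hDf : ∀ σ, imagTimeWeight β M₂ * Pf σ ≤ Df / L₁) :
    (∀ m ∈ ({omega0 M₂, (omega0 M₂).rev} : Finset (MatsubaraIdx M₂)), ∀ σ : Fin 2, imagTimeWeight β M₂ * ∑ ybar : TorusSite 2 L₁,
        (‖(∑ t₁ : ImagTimeIdx M₂,
              sectorisedKernel L₁ M₂ β (trivialMultiplier L₁ M₂)
                  (klEffectiveAction L₁ M₂ β U μ (klFlowFrameU L₁ M₂ β U μ (nScales β + 1)) klE0 (nScales β + 1) - counterQuadratic L₁ M₂ β (klFlowFrameU L₁ M₂ β U μ (nScales β + 1))) 2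
                  (![((0, σ), 0), ((0, σ), 1)] : Fin 2 → SectorLeg 1) ![oc, (t₁, oc.2 + ybar)] *
                Complex.exp (((matsubaraFreq β M₂ m * (imagTime β M₂ oc.1 - imagTime β M₂ t₁) : ℝ) : ℂ) * I)) -
            (∑ t₁ : ImagTimeIdx M₂,
              sectorisedKernel L₂ M₂ β (trivialMultiplier L₂ M₂)
                  (klEffectiveAction L₂ M₂ β U μ (klFlowFrameU L₂ M₂ β U μ (nScales β + 1)) klE0 (nScales β + 1) - counterQuadratic L₂ M₂ β (klFlowFrameU L₂ M₂ β U μ (nScales β + 1))) 2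
                  (![((0, σ), 0), ((0, σ), 1)] : Fin 2 → SectorLeg 1) ![of, (t₁, of.2 + Torus.proj L₂ (Torus.cRep ybar))] *
                Complex.exp (((matsubaraFreq β M₂ m * (imagTime β M₂ of.1 - imagTime β M₂ t₁) : ℝ) : ℂ) * I))‖ +
          ‖(∑ t₁ : ImagTimeIdx M₂,
              sectorisedKernel L₁ M₂ β (trivialMultiplier L₁ M₂)
                  (klEffectiveAction L₁ M₂ β U μ (klFlowFrameU L₁ M₂ β U μ (nScales β + 1)) klE0 (nScales β + 1) - counterQuadratic L₁ M₂ β (klFlowFrameU L₁ M₂ β U μ (nScales β + 1))) 2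
                  (![((0, σ), 0), ((0, σ), 1)] : Fin 2 → SectorLeg 1) ![oc, (t₁, oc.2 + -ybar)] *
                Complex.exp (((matsubaraFreq β M₂ m * (imagTime β M₂ oc.1 - imagTime β M₂ t₁) : ℝ) : ℂ) * I)) -
            (∑ t₁ : ImagTimeIdx M₂,
              sectorisedKernel L₂ M₂ β (trivialMultiplier L₂ M₂)
                  (klEffectiveAction L₂ M₂ β U μ (klFlowFrameU L₂ M₂ β U μ (nScales β + 1)) klE0 (nScales β + 1) - counterQuadratic L₂ M₂ β (klFlowFrameU L₂ M₂ β U μ (nScales β + 1))) 2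
                  (![((0, σ), 0), ((0, σ), 1)] : Fin 2 → SectorLeg 1) ![of, (t₁, of.2 + -Torus.proj L₂ (Torus.cRep ybar))] *
                Complex.exp (((matsubaraFreq β M₂ m * (imagTime β M₂ of.1 - imagTime β M₂ t₁) : ℝ) : ℂ) * I))‖) ≤ Dd / L₁) ∧
    (∀ m ∈ ({omega0 M₂, (omega0 M₂).rev} : Finset (MatsubaraIdx M₂)), ∀ σ : Fin 2, imagTimeWeight β M₂ *
        ∑ y ∈ univ.filter (fun y : TorusSite 2 L₂ => Torus.proj L₂ (Torus.cRep (fun i => (((y i).val : ℕ) : ZMod L₁))) ≠ y),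
          (‖(∑ t₁ : ImagTimeIdx M₂,
              sectorisedKernel L₂ M₂ β (trivialMultiplier L₂ M₂)
                  (klEffectiveAction L₂ M₂ β U μ (klFlowFrameU L₂ M₂ β U μ (nScales β + 1)) klE0 (nScales β + 1) - counterQuadratic L₂ M₂ β (klFlowFrameU L₂ M₂ β U μ (nScales β + 1))) 2
                  (![((0, σ), 0), ((0, σ), 1)] : Fin 2 → SectorLeg 1) ![of, (t₁, of.2 + y)] *
                Complex.exp (((matsubaraFreq β M₂ m * (imagTime β M₂ of.1 - imagTime β M₂ t₁) : ℝ) : ℂ) * I))‖ +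
            ‖(∑ t₁ : ImagTimeIdx M₂,
              sectorisedKernel L₂ M₂ β (trivialMultiplier L₂ M₂)
                  (klEffectiveAction L₂ M₂ β U μ (klFlowFrameU L₂ M₂ β U μ (nScales β + 1)) klE0 (nScales β + 1) - counterQuadratic L₂ M₂ β (klFlowFrameU L₂ M₂ β U μ (nScales β + 1))) 2
                  (![((0, σ), 0), ((0, σ), 1)] : Fin 2 → SectorLeg 1) ![of, (t₁, of.2 + -y)] *
                Complex.exp (((matsubaraFreq β M₂ m * (imagTime β M₂ of.1 - imagTime β M₂ t₁) : ℝ) : ℂ) * I))‖) ≤ Df / L₁) :=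
  hdualSp_point_of_commonFrame_add_conversion hβ.le U μ (nScales β + 1) oc of ht
    (Pe := fun _ => N_D ^ 2 * ρ + 2 * N_D * ρ * (2 + imagTimeWeight β M₂ * N_D * ρ) * S)
    hPc (hPe_lastScale_le_of_fourier hL hβ U μ of hZ₁ hS0 hND hρ hS) hPf hDd hDf

/-- **`ρ` discharged**: for an ADMISSIBLE coarse frame `K₁` (`FrameOK`), `klBetaMin ≤ β`, `β³ ≤ M₂`, the body of `hdualSp` at the last scale from `Pc`, `Pf`, `N_D`, `S` and the
EXPLICIT crude constant `A⋆ = 14√Q_{nScales β+1}` of ✓ `ScaleZeroDecay.eps_mul_charSum_gridSymbol_twoM_le_A1`. [cite: BenfattoGiulianiMastropietro2006, §2.4 (2.38)] -/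
theorem hdualSp_point_lastScale_of_frameOK (hL : L₁ ≤ L₂) {β : ℝ} (hβ : klBetaMin ≤ β) (hβM : β ^ 3 ≤ (M₂ : ℝ)) {Rc : RenConsts} {Nsc : ℕ} (U μ : ℝ)
    (hK₁ : FrameOK Rc U Nsc μ (klFlowFrameU L₁ M₂ β U μ (nScales β + 1))) (oc : SpaceTimeIdx L₁ M₂) (of : SpaceTimeIdx L₂ M₂)
    (ht : of.1 = oc.1)
    (hZ₁ : IsUnit (effPartitionFn ℂ (normalCovariance L₂ M₂ (uvSymbolCT L₂ M₂ β μ (klFlowFrameU L₁ M₂ β U μ (nScales β + 1)) (klScale klE0 (nScales β + 1))))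
      (hubbardInteraction L₂ M₂ β U + counterQuadratic L₂ M₂ β (klFlowFrameU L₁ M₂ β U μ (nScales β + 1)))))
    {N_D S : ℝ} (hS0 : 0 ≤ S)
    (hND : ∑ z : TorusSite 2 L₂, ‖framePosKernel L₂ (fsub (klFlowFrameU L₂ M₂ β U μ (nScales β + 1)) (klFlowFrameU L₁ M₂ β U μ (nScales β + 1))) z‖ ≤ N_D)
    (hS : ∀ (σ : Fin 2) (y₀ : SpaceTimeIdx L₂ M₂),
      fixedTupleL1 L₂ M₂ β 1 (sectorisedKernel L₂ M₂ β (trivialMultiplier L₂ M₂)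
          (klEffectiveAction L₂ M₂ β U μ (klFlowFrameU L₁ M₂ β U μ (nScales β + 1)) klE0 (nScales β + 1)) 2)
        (![((0, σ), 0), ((0, σ), 1)] : Fin 2 → SectorLeg 1) y₀ ≤ S)
    {Pc Pf : Fin 2 → ℝ} {Dd Df : ℝ}
    (hPc : ∀ σ : Fin 2, ∑ t₁ : ImagTimeIdx M₂, ∑ ybar : TorusSite 2 L₁,
        (‖sectorisedKernel L₁ M₂ β (trivialMultiplier L₁ M₂)
              (klEffectiveAction L₁ M₂ β U μ (klFlowFrameU L₁ M₂ β U μ (nScales β + 1)) klE0 (nScales β + 1) - counterQuadratic L₁ M₂ β (klFlowFrameU L₁ M₂ β U μ (nScales β + 1))) 2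
              (![((0, σ), 0), ((0, σ), 1)] : Fin 2 → SectorLeg 1) ![oc, (t₁, oc.2 + ybar)] -
            sectorisedKernel L₂ M₂ β (trivialMultiplier L₂ M₂)
              (klEffectiveAction L₂ M₂ β U μ (klFlowFrameU L₁ M₂ β U μ (nScales β + 1)) klE0 (nScales β + 1) - counterQuadratic L₂ M₂ β (klFlowFrameU L₁ M₂ β U μ (nScales β + 1))) 2
              (![((0, σ), 0), ((0, σ), 1)] : Fin 2 → SectorLeg 1) ![of, (t₁, of.2 + Torus.proj L₂ (Torus.cRep ybar))]‖ +
          ‖sectorisedKernel L₁ M₂ β (trivialMultiplier L₁ M₂)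
              (klEffectiveAction L₁ M₂ β U μ (klFlowFrameU L₁ M₂ β U μ (nScales β + 1)) klE0 (nScales β + 1) - counterQuadratic L₁ M₂ β (klFlowFrameU L₁ M₂ β U μ (nScales β + 1))) 2
              (![((0, σ), 0), ((0, σ), 1)] : Fin 2 → SectorLeg 1) ![oc, (t₁, oc.2 + -ybar)] -
            sectorisedKernel L₂ M₂ β (trivialMultiplier L₂ M₂)
              (klEffectiveAction L₂ M₂ β U μ (klFlowFrameU L₁ M₂ β U μ (nScales β + 1)) klE0 (nScales β + 1) - counterQuadratic L₂ M₂ β (klFlowFrameU L₁ M₂ β U μ (nScales β + 1))) 2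
              (![((0, σ), 0), ((0, σ), 1)] : Fin 2 → SectorLeg 1) ![of, (t₁, of.2 + -Torus.proj L₂ (Torus.cRep ybar))]‖) ≤ Pc σ)
    (hPf : ∀ σ : Fin 2, ∑ t₁ : ImagTimeIdx M₂,
        ∑ y ∈ univ.filter (fun y : TorusSite 2 L₂ => Torus.proj L₂ (Torus.cRep (fun i => (((y i).val : ℕ) : ZMod L₁))) ≠ y),
          (‖sectorisedKernel L₂ M₂ β (trivialMultiplier L₂ M₂)
                (klEffectiveAction L₂ M₂ β U μ (klFlowFrameU L₂ M₂ β U μ (nScales β + 1)) klE0 (nScales β + 1) - counterQuadratic L₂ M₂ β (klFlowFrameU L₂ M₂ β U μ (nScales β + 1))) 2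
                (![((0, σ), 0), ((0, σ), 1)] : Fin 2 → SectorLeg 1) ![of, (t₁, of.2 + y)]‖ +
            ‖sectorisedKernel L₂ M₂ β (trivialMultiplier L₂ M₂)
                (klEffectiveAction L₂ M₂ β U μ (klFlowFrameU L₂ M₂ β U μ (nScales β + 1)) klE0 (nScales β + 1) - counterQuadratic L₂ M₂ β (klFlowFrameU L₂ M₂ β U μ (nScales β + 1))) 2
                (![((0, σ), 0), ((0, σ), 1)] : Fin 2 → SectorLeg 1) ![of, (t₁, of.2 + -y)]‖) ≤ Pf σ)
    (hDd : ∀ σ, imagTimeWeight β M₂ * Pc σ +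
      (N_D ^ 2 * (14 * Real.sqrt ((1 / 2 + 12 / klScale klE0 (nScales β + 1)) *
        (2 / klScale klE0 (nScales β + 1) + 128 * Real.pi ^ 4 * (4 * (1110 : ℝ) + 6 * (32 / 3) + 2) ^ 2 / klScale klE0 (nScales β + 1) +
          2 * Real.pi ^ 5 * (4 * (1110 : ℝ) + 6 * (32 / 3) + 2) ^ 2 / klScale klE0 (nScales β + 1) ^ 2 + 1 +
          Real.pi ^ 4 * ((7 : ℝ) ^ 2 * (4 * (1110 : ℝ) + 6 * (32 / 3) + 2) * (2 / klScale klE0 (nScales β + 1)) + 7 * (2 * (32 / 3) + 1)) ^ 2 /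
            klScale klE0 (nScales β + 1) ^ 3))) +
        2 * N_D * (14 * Real.sqrt ((1 / 2 + 12 / klScale klE0 (nScales β + 1)) *
        (2 / klScale klE0 (nScales β + 1) + 128 * Real.pi ^ 4 * (4 * (1110 : ℝ) + 6 * (32 / 3) + 2) ^ 2 / klScale klE0 (nScales β + 1) +
          2 * Real.pi ^ 5 * (4 * (1110 : ℝ) + 6 * (32 / 3) + 2) ^ 2 / klScale klE0 (nScales β + 1) ^ 2 + 1 +
          Real.pi ^ 4 * ((7 : ℝ) ^ 2 * (4 * (1110 : ℝ) + 6 * (32 / 3) + 2) * (2 / klScale klE0 (nScales β + 1)) + 7 * (2 * (32 / 3) + 1)) ^ 2 /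
            klScale klE0 (nScales β + 1) ^ 3))) *
          (2 + N_D * (14 * Real.sqrt ((1 / 2 + 12 / klScale klE0 (nScales β + 1)) *
        (2 / klScale klE0 (nScales β + 1) + 128 * Real.pi ^ 4 * (4 * (1110 : ℝ) + 6 * (32 / 3) + 2) ^ 2 / klScale klE0 (nScales β + 1) +
          2 * Real.pi ^ 5 * (4 * (1110 : ℝ) + 6 * (32 / 3) + 2) ^ 2 / klScale klE0 (nScales β + 1) ^ 2 + 1 +
          Real.pi ^ 4 * ((7 : ℝ) ^ 2 * (4 * (1110 : ℝ) + 6 * (32 / 3) + 2) * (2 / klScale klE0 (nScales β + 1)) + 7 * (2 * (32 / 3) + 1)) ^ 2 /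
            klScale klE0 (nScales β + 1) ^ 3)))) * S) ≤ Dd / L₁)
    (hDf : ∀ σ, imagTimeWeight β M₂ * Pf σ ≤ Df / L₁) :
    (∀ m ∈ ({omega0 M₂, (omega0 M₂).rev} : Finset (MatsubaraIdx M₂)), ∀ σ : Fin 2, imagTimeWeight β M₂ * ∑ ybar : TorusSite 2 L₁,
        (‖(∑ t₁ : ImagTimeIdx M₂,
              sectorisedKernel L₁ M₂ β (trivialMultiplier L₁ M₂)
                  (klEffectiveAction L₁ M₂ β U μ (klFlowFrameU L₁ M₂ β U μ (nScales β + 1)) klE0 (nScales β + 1) - counterQuadratic L₁ M₂ β (klFlowFrameU L₁ M₂ β U μ (nScales β + 1))) 2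
                  (![((0, σ), 0), ((0, σ), 1)] : Fin 2 → SectorLeg 1) ![oc, (t₁, oc.2 + ybar)] *
                Complex.exp (((matsubaraFreq β M₂ m * (imagTime β M₂ oc.1 - imagTime β M₂ t₁) : ℝ) : ℂ) * I)) -
            (∑ t₁ : ImagTimeIdx M₂,
              sectorisedKernel L₂ M₂ β (trivialMultiplier L₂ M₂)
                  (klEffectiveAction L₂ M₂ β U μ (klFlowFrameU L₂ M₂ β U μ (nScales β + 1)) klE0 (nScales β + 1) - counterQuadratic L₂ M₂ β (klFlowFrameU L₂ M₂ β U μ (nScales β + 1))) 2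
                  (![((0, σ), 0), ((0, σ), 1)] : Fin 2 → SectorLeg 1) ![of, (t₁, of.2 + Torus.proj L₂ (Torus.cRep ybar))] *
                Complex.exp (((matsubaraFreq β M₂ m * (imagTime β M₂ of.1 - imagTime β M₂ t₁) : ℝ) : ℂ) * I))‖ +
          ‖(∑ t₁ : ImagTimeIdx M₂,
              sectorisedKernel L₁ M₂ β (trivialMultiplier L₁ M₂)
                  (klEffectiveAction L₁ M₂ β U μ (klFlowFrameU L₁ M₂ β U μ (nScales β + 1)) klE0 (nScales β + 1) - counterQuadratic L₁ M₂ β (klFlowFrameU L₁ M₂ β U μ (nScales β + 1))) 2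
                  (![((0, σ), 0), ((0, σ), 1)] : Fin 2 → SectorLeg 1) ![oc, (t₁, oc.2 + -ybar)] *
                Complex.exp (((matsubaraFreq β M₂ m * (imagTime β M₂ oc.1 - imagTime β M₂ t₁) : ℝ) : ℂ) * I)) -
            (∑ t₁ : ImagTimeIdx M₂,
              sectorisedKernel L₂ M₂ β (trivialMultiplier L₂ M₂)
                  (klEffectiveAction L₂ M₂ β U μ (klFlowFrameU L₂ M₂ β U μ (nScales β + 1)) klE0 (nScales β + 1) - counterQuadratic L₂ M₂ β (klFlowFrameU L₂ M₂ β U μ (nScales β + 1))) 2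
                  (![((0, σ), 0), ((0, σ), 1)] : Fin 2 → SectorLeg 1) ![of, (t₁, of.2 + -Torus.proj L₂ (Torus.cRep ybar))] *
                Complex.exp (((matsubaraFreq β M₂ m * (imagTime β M₂ of.1 - imagTime β M₂ t₁) : ℝ) : ℂ) * I))‖) ≤ Dd / L₁) ∧
    (∀ m ∈ ({omega0 M₂, (omega0 M₂).rev} : Finset (MatsubaraIdx M₂)), ∀ σ : Fin 2, imagTimeWeight β M₂ *
        ∑ y ∈ univ.filter (fun y : TorusSite 2 L₂ => Torus.proj L₂ (Torus.cRep (fun i => (((y i).val : ℕ) : ZMod L₁))) ≠ y),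
          (‖(∑ t₁ : ImagTimeIdx M₂,
              sectorisedKernel L₂ M₂ β (trivialMultiplier L₂ M₂)
                  (klEffectiveAction L₂ M₂ β U μ (klFlowFrameU L₂ M₂ β U μ (nScales β + 1)) klE0 (nScales β + 1) - counterQuadratic L₂ M₂ β (klFlowFrameU L₂ M₂ β U μ (nScales β + 1))) 2
                  (![((0, σ), 0), ((0, σ), 1)] : Fin 2 → SectorLeg 1) ![of, (t₁, of.2 + y)] *
                Complex.exp (((matsubaraFreq β M₂ m * (imagTime β M₂ of.1 - imagTime β M₂ t₁) : ℝ) : ℂ) * I))‖ +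
            ‖(∑ t₁ : ImagTimeIdx M₂,
              sectorisedKernel L₂ M₂ β (trivialMultiplier L₂ M₂)
                  (klEffectiveAction L₂ M₂ β U μ (klFlowFrameU L₂ M₂ β U μ (nScales β + 1)) klE0 (nScales β + 1) - counterQuadratic L₂ M₂ β (klFlowFrameU L₂ M₂ β U μ (nScales β + 1))) 2
                  (![((0, σ), 0), ((0, σ), 1)] : Fin 2 → SectorLeg 1) ![of, (t₁, of.2 + -y)] *
                Complex.exp (((matsubaraFreq β M₂ m * (imagTime β M₂ of.1 - imagTime β M₂ t₁) : ℝ) : ℂ) * I))‖) ≤ Df / L₁) := by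
  have hβ0 : 0 < β := ScaleZeroDecay.beta_pos_of_klBetaMin_le hβ
  -- the grid symbol of `uvSymbolCT` does not read the spin
  have hsp : ∀ (τ : Fin 2) (q₀ : TorusSite 1 (2 * M₂)) (qv : TorusSite 2 L₂),
      gridSymbol L₂ M₂ (2 * M₂) β (uvSymbolCT L₂ M₂ β μ (klFlowFrameU L₁ M₂ β U μ (nScales β + 1)) (klScale klE0 (nScales β + 1))) τ q₀ qv =
        gridSymbol L₂ M₂ (2 * M₂) β (uvSymbolCT L₂ M₂ β μ (klFlowFrameU L₁ M₂ β U μ (nScales β + 1)) (klScale klE0 (nScales β + 1))) 0 q₀ qv :=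
    fun _ _ _ => rfl
  have hA := ScaleZeroDecay.eps_mul_charSum_gridSymbol_twoM_le_A1 (L := L₂) (nScales β + 1) hK₁ hβ hβM 0
  have hMr : (0 : ℝ) < M₂ := Nat.cast_pos.2 (NeZero.pos M₂)
  have hε : 0 ≤ imagTimeWeight β M₂ := imagTimeWeight_nonneg hβ0.le M₂
  have hN0 : 0 ≤ N_D := (sum_nonneg fun _ _ => norm_nonneg _).trans hND
  set ρ₀ : ℝ := ∑ a : TorusSite 1 (2 * M₂), ∑ bv : TorusSite 2 L₂, ‖∑ q₀ : TorusSite 1 (2 * M₂), ∑ qv : TorusSite 2 L₂,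
      torusChar q₀ a * torusChar qv bv *
        gridSymbol L₂ M₂ (2 * M₂) β (uvSymbolCT L₂ M₂ β μ (klFlowFrameU L₁ M₂ β U μ (nScales β + 1)) (klScale klE0 (nScales β + 1))) 0 q₀ qv‖ with hρ₀
  have hρ0 : (0 : ℝ) ≤ ρ₀ := sum_nonneg fun _ _ => sum_nonneg fun _ _ => norm_nonneg _
  have hρτ : ∀ τ : Fin 2, ∑ a : TorusSite 1 (2 * M₂), ∑ bv : TorusSite 2 L₂, ‖∑ q₀ : TorusSite 1 (2 * M₂), ∑ qv : TorusSite 2 L₂,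
      torusChar q₀ a * torusChar qv bv *
        gridSymbol L₂ M₂ (2 * M₂) β (uvSymbolCT L₂ M₂ β μ (klFlowFrameU L₁ M₂ β U μ (nScales β + 1)) (klScale klE0 (nScales β + 1))) τ q₀ qv‖ ≤ ρ₀ := by
    intro τ
    simp_rw [hsp τ]
    exact le_rfl
  refine hdualSp_point_lastScale_of_fourier hL hβ0 U μ oc of ht hZ₁ hS0 hND hρτ hS hPc hPf (fun σ => ?_) hDf
  rw [mul_add]
  exact (add_le_add le_rfl (eps_mul_conversionBound_le hε hN0 hρ0 hS0 hA)).trans (hDd σ)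

end LastScale

end Summit.HubbardSuperconductivity.HubbardSuperconductivity.Theorems.TwoVolumeDefect

end

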